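import Mathlib
import HarnessLib
import Summits.QuantumFields.YangMills.Theses.MirrorModularBoosts
import Literature.MathematicalPhysics.QuantumFieldTheory.OSSectorContinuation
import Literature.MathematicalPhysics.QuantumFieldTheory.OSReconstructionNoE1

/-!
# Sketch — first lemmas of the crux-idea cards for `PlanarSpectralCone` (stmt-QuantumFields-9664)

Ideator 2, round 1. Statements only (sorried); they must elaborate over existing declarations.

* `lightConeSectorData` — card `lightcone-sector-engine`: the two diagonal OS semigroups are
  sector data of opening `π/2` (the tree's `LogSlot.IsSectorData`, OS II Ch. V engine) in the two
  LIGHT-CONE variables `(u, u') = ((x₀+x₁)/√2, (x₀−x₁)/√2)` for wedge-chain supported `F`, `G`.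
* `planarConeSupport` — the transfer target C⁺ of the same card: the joint spectral measure of
  `(H, P⃗)` of every time-ordered field vector of the `e₀`-reconstruction is carried by
  `{p₀ ≥ |p₁|}`.
* `quarterTurn_pos`, `quarterTurn_completelyMonotone` — card `two-mirror-quarter-turn`: the
  quarter-turn form `G ↦ 𝔖(ΘG* ⊗ G∘ρ⁻¹)` on fourth-quadrant vectors is positive, and its values
  along the light ray `s ↦ G_{s n}`, `n = (e₀ − e₁)/√2`, are Laplace transforms of positive measures.
-/

namespace Summit.QuantumFields.YangMills.Cruxes.PlanarSpectralCone.Sketch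

open scoped BigOperators Topology Classical MeasureTheory InnerProductSpace ComplexConjugate
open Filter Set Function MeasureTheory
open Literature.MathematicalPhysics.QuantumLattice Literature.MathematicalPhysics.AQFT
  Literature.MathematicalPhysics.QuantumFieldTheory

local notation "E4" => EuclideanSpace ℝ (Fin 4)

/-- The hypotheses of the crux `PlanarSpectralCone`, bundled (verbatim the four premises of the
route decl). -/
def PlanarHyps (S : SchwingerFamily E4) : Prop :=
  S.toLabelled.HasLinearGrowth ∧ S.toLabelled.IsSymmetric ∧
  (∀ (n : ℕ) (a : E4) (F : SchwartzMap (Fin n → E4) ℂ), IsOffDiagonal F →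
    S n (translateMulti a F) = S n F) ∧
  (∀ (R : E4 ≃ₗᵢ[ℝ] E4) (a b : ℝ), a ^ 2 + b ^ 2 = 1 → (a = 0 ∨ b = 0 ∨ a ^ 2 = b ^ 2) →
    R (EuclideanSpace.single 0 1) = a • EuclideanSpace.single 0 1 + b • EuclideanSpace.single 1 1 →
    (SchwingerFamily.toLabelled (fun n => (S n).comp (linActMulti R))).IsReflectionPositive)

/-- Forward-wedge CONE CHAINS: every point in the open wedge `{x₀ > |x₁|}` and successive
differences in the open forward cone (so the points are ordered the same way along `e₀`, along
`(e₀+e₁)/√2` and along `(e₀−e₁)/√2`). -/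
def coneChain (n : ℕ) : Set (Fin n → E4) :=
  {x | (∀ i, |x i 1| < x i 0) ∧ ∀ i j, i < j → |x j 1 - x i 1| < x j 0 - x i 0}

/-- The Euclidean point with light-cone coordinates `u = (u 0, u 1)`:
`x(u) = ((u₀+u₁)/√2) e₀ + ((u₀−u₁)/√2) e₁`. -/
noncomputable def lcPoint (u : Fin 2 → ℝ) : E4 :=
  ((u 0 + u 1) / Real.sqrt 2) • EuclideanSpace.single 0 1 +
    ((u 0 - u 1) / Real.sqrt 2) • EuclideanSpace.single 1 1

/-- **Card `lightcone-sector-engine`, first lemma.** For wedge-chain supported time-ordered `F`,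
`G`, the function `N(u) = 𝔖_{n+m}(ΘF* ⊗ G_{x(u)})` on the open quadrant of light-cone coordinates,
together with its two one-variable continuations (frame `(e₀+e₁)/√2` in the slot `u₀`, frame
`(e₀−e₁)/√2` in the slot `u₁`), is sector data of opening `π/2` with polynomial degree `0` and a
constant sub-sector bound (`LogSlot.IsSectorData (π/2) N E C 0 (fun _ => C)`). Feeding it to
`IsSectorData.exists_extension` / `IsSectorData.norm_extension_le` gives `N` holomorphic and
bounded by `C` on `{Re u, Re u' > 0, |arg u| + |arg u'| < π/2}`, which contains the Minkowski rays
`(r e^{-iα}, r e^{iα})`, `|α| < π/4`. -/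
theorem lightConeSectorData (S : SchwingerFamily E4) (hS : PlanarHyps S)
    (n m : ℕ) (F : SchwartzMap (Fin n → E4) ℂ) (G : SchwartzMap (Fin m → E4) ℂ)
    (hF : IsTimeOrdered F) (hG : IsTimeOrdered G)
    (hFw : tsupport (F : (Fin n → E4) → ℂ) ⊆ coneChain n)
    (hGw : tsupport (G : (Fin m → E4) → ℂ) ⊆ coneChain m) :
    ∃ (N : (Fin 2 → ℝ) → ℂ) (Eslot : Fin 2 → (Fin 1 → ℝ) → ℂ → ℂ) (C : ℝ),
      LogSlot.IsSectorData (Real.pi / 2) N Eslot C 0 (fun _ => C) ∧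
      ∀ u : Fin 2 → ℝ, (∀ j, 0 < u j) →
        ∀ H : SchwartzMap (Fin (n + m) → E4) ℂ,
          IsAppendTensorOf H (osAdjoint F) (translateMulti (lcPoint u) G) → N u = S (n + m) H := by
  sorry

/-- **Card `lightcone-sector-engine`, transfer target C⁺ (support first).** Under the crux
hypotheses, the joint spectral measure of `(H, P⃗)` of every time-ordered field vector of the
`e₀`-reconstruction (`OSReconstructionNoE1`, no E1 used) gives no mass to `{p₀ < |p₁|}`. The typed
conclusion of `PlanarSpectralCone` (holomorphic `Φ` on `{|Im β| < Re ζ}` with the Cauchy–Schwarz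
bound) is then the spectral integral `∫ e^{-ζp₀ + iβp₁} dμ_{Ψ_F,Ψ_G}` by polarisation. -/
theorem planarConeSupport (S : SchwingerFamily E4) (hS : PlanarHyps S)
    (h : OSReconstructionNoE1 S.toLabelled)
    (n : ℕ) (F : SchwartzMap (Fin n → E4) ℂ) (hF : IsTimeOrdered F)
    (μ : Measure E4) (hμ : h.IsJointSpectralMeasure (h.fieldVec n (fun _ => ()) F hF) μ) :
    μ {p | p 0 < |p 1|} = 0 := by
  sorry

/-- Fourth-quadrant DOUBLY ORDERED supports: every point in `{x₀ > 0, x₁ < 0}`, times increasing,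
first spatial coordinates decreasing (so that both `G` and its quarter turn `G∘ρ⁻¹` are
time-ordered, and `G` is also ordered along `(e₀−e₁)/√2`). -/
def quadChain (n : ℕ) : Set (Fin n → E4) :=
  {x | (∀ i, 0 < x i 0 ∧ x i 1 < 0) ∧ StrictMono (fun i => x i 0) ∧ StrictAnti (fun i => x i 1)}

/-- The quarter turn of the `(x₀,x₁)`-plane taking the fourth quadrant `{x₀>0, x₁<0}` onto the
first: `ρ e₀ = e₁`, `ρ e₁ = −e₀`, `ρ` fixes `e₂`, `e₃` (so `ρ(x₀,x₁,…) = (−x₁, x₀, …)`). -/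
def IsQuarterTurn (ρ : E4 ≃ₗᵢ[ℝ] E4) : Prop :=
  ρ (EuclideanSpace.single 0 1) = EuclideanSpace.single 1 1 ∧
  ρ (EuclideanSpace.single 1 1) = -EuclideanSpace.single 0 1 ∧
  ρ (EuclideanSpace.single 2 1) = EuclideanSpace.single 2 1 ∧
  ρ (EuclideanSpace.single 3 1) = EuclideanSpace.single 3 1

/-- The light-ray direction `n = (e₀ − e₁)/√2` (unit normal of the mirror `x₀ = x₁`, pointing into
`{x₀ > x₁}`; translation by `s n`, `s ≥ 0`, preserves the fourth quadrant). -/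
noncomputable def nVec : E4 :=
  (Real.sqrt 2)⁻¹ • (EuclideanSpace.single 0 1 - EuclideanSpace.single 1 1)

/-- **Card `two-mirror-quarter-turn`, first lemma (a): positivity of the quarter-turn form.**
For doubly ordered fourth-quadrant `G`, `𝔖_{2n}(ΘG* ⊗ G∘ρ⁻¹) ≥ 0`: the `e₀`-inner product of
`Ψ⁰_G` with its quarter-turned partner is the squared norm of `Ψ_{G∘ρ⁻¹}` in the OS space of the
ANTI-DIAGONAL mirror `x₀ = −x₁` (`θ₋ ∘ ρ = θ`). This is the operator `𝒥 : Ψ⁰_G ↦ Ψ⁰_{G∘ρ⁻¹}`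
being positive. -/
theorem quarterTurn_pos (S : SchwingerFamily E4) (hS : PlanarHyps S)
    (ρ : E4 ≃ₗᵢ[ℝ] E4) (hρ : IsQuarterTurn ρ)
    (n : ℕ) (G : SchwartzMap (Fin n → E4) ℂ)
    (hGq : tsupport (G : (Fin n → E4) → ℂ) ⊆ quadChain n)
    (H : SchwartzMap (Fin (n + n) → E4) ℂ) (hH : IsAppendTensorOf H (osAdjoint G) (linActMulti ρ G)) :
    0 ≤ (S (n + n) H).re ∧ (S (n + n) H).im = 0 := by
  sorry

/-- **Card `two-mirror-quarter-turn`, first lemma (b): complete monotonicity along the light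
ray.** For doubly ordered fourth-quadrant `G`, the quarter-turn-twisted `e₀`-matrix elements along
the light-ray translations `s ↦ G_{s n}`, i.e. `s ↦ ⟪Ψ⁰_G, 𝒥 e^{-(s/√2)(H + iP₁)} Ψ⁰_G⟫`, are the
Laplace transform of a finite positive measure on `[0, ∞)` (the spectral measure of the
anti-diagonal Hamiltonian in the vector `Ψ₋_{G∘ρ⁻¹}`): the light-like generator `H + iP₁` is
POSITIVE in the `𝒥`-twisted inner product. -/
theorem quarterTurn_completelyMonotone (S : SchwingerFamily E4) (hS : PlanarHyps S)
    (ρ : E4 ≃ₗᵢ[ℝ] E4) (hρ : IsQuarterTurn ρ)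
    (n : ℕ) (G : SchwartzMap (Fin n → E4) ℂ)
    (hGq : tsupport (G : (Fin n → E4) → ℂ) ⊆ quadChain n) :
    ∃ ν : Measure ℝ, IsFiniteMeasure ν ∧ ν (Set.Iio 0) = 0 ∧
      ∀ s : ℝ, 0 ≤ s → ∀ H : SchwartzMap (Fin (n + n) → E4) ℂ,
        IsAppendTensorOf H (osAdjoint G) (linActMulti ρ (translateMulti (s • nVec) G)) →
          S (n + n) H = ∫ l, Complex.exp (-((s * l : ℝ) : ℂ)) ∂ν := by
  sorry

end Summit.QuantumFields.YangMills.Cruxes.PlanarSpectralCone.Sketch
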